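import Summits.SmoothPoincare4.SmoothPoincare4.Theorems.SymplecticOrigamiOrigamiFoldExistenceStubCleanOnePleatIroningRadial
import Literature.Topology.FourManifolds.CollarUniquenessBall

/-!
# Stub `stub_cleanOnePleatIroning` of line `shadow-pleats` for crux `OrigamiFoldExistence` — XII:
# straightening the collar: a filling of the crease that CONTINUES the chart shadow
(item stmt-SmoothPoincare4-7844, route SymplecticOrigami; seat c3, S5a worker, wave 2)

Twelfth helper file for the registered stub `stub_cleanOnePleatIroning` (S5a): step (S3)
(collar correction) of its remaining ingredient `CleanPleatIroningChart` (file III), abstract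
form; it imports only file VI (the inner collar of file XI is an INPUT here).  In the setting of
files X–XI (`G, Λ₀ : ℝ⁴ → ℝ⁴` smooth, `Λ₀ = G` on `S_R`, `Λ₀` an injective immersion of
`B_{R'}`, `G` an injective immersion of the open shell `{R - η₀ < |u| < R + η₀}`, and an inner
collar `θ` of the unit sphere with `Λ₀ (R θ x) = G (R x)` on a closed shell):

* `exists_filling_of_innerCollar` (registered sub-goal) — **there is a smooth `Λ : ℝ⁴ → ℝ⁴`,
  injective and immersive on the closed ball `B̄_R`, which AGREES WITH `G` OUTSIDE `B_{R-η}`**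
  for some `η ∈ (0, η₀]`.  Construction: the inner collar `θ = R⁻¹ Λ₀⁻¹ G (R ·)` of file XI
  is straightened by the tree's uniqueness of collars
  (`IsInnerCollar.exists_openPartialHomeomorph_extend`, `CollarUniquenessBall.lean`): a
  diffeomorphism `Θ` of the open unit ball equal to `θ` on a thin shell `{1 - δ' ≤ |x| < 1}`
  and to the identity inside; then `Λ = Λ₀ (R Θ(u/R))` on `B_R` and `Λ = G` outside agree on
  the shell `{R(1 - δ') ≤ |u| < R}`, so `Λ` is smooth, and it is injective/immersive on `B̄_R`
  because `Λ₀ ∘ (R Θ (·/R))` is a diffeomorphism of `B_R` onto `Λ₀(B_R)`, whose closure meets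
  the crease `G(S_R) = Λ₀(S_R)` only along the sphere.

Sources: M. W. Hirsch, *Differential Topology* (1976), Ch. 8 Thm. 1.8–1.9 (uniqueness of
collars, smoothing along a seam); tree file `CollarUniquenessBall.lean`.
-/

noncomputable section

-- the prescribed namespace `Summit.<P>.<Sub>.…` duplicates `SmoothPoincare4` (P = Sub)
set_option linter.dupNamespace false

open scoped Manifold ContDiff Topology RealInnerProductSpace
open Set Function Filter Metric Module

namespace Summit.SmoothPoincare4.SmoothPoincare4.Theorems.OrigamiFoldExistence.ShadowPleats

section Straighten

variable {G Λ₀ : EuclideanSpace ℝ (Fin 4) → EuclideanSpace ℝ (Fin 4)}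

/-- The differential of an open partial homeomorphism which is smooth in both directions on
its source/target is injective. -/
theorem injective_fderiv_of_symm {Θ : OpenPartialHomeomorph (EuclideanSpace ℝ (Fin 4)) (EuclideanSpace ℝ (Fin 4))}
    (hΘ : ContDiffOn ℝ ∞ Θ Θ.source) (hΘs : ContDiffOn ℝ ∞ Θ.symm Θ.target)
    {x : EuclideanSpace ℝ (Fin 4)} (hx : x ∈ Θ.source) : Injective (fderiv ℝ Θ x) := by
  have hn : (∞ : WithTop ℕ∞) ≠ 0 := by simp
  have hd : DifferentiableAt ℝ Θ x :=
    (hΘ.differentiableOn hn x hx).differentiableAt (Θ.open_source.mem_nhds hx)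
  have hds : DifferentiableAt ℝ Θ.symm (Θ x) :=
    (hΘs.differentiableOn hn _ (Θ.map_source hx)).differentiableAt
      (Θ.open_target.mem_nhds (Θ.map_source hx))
  have hcomp : fderiv ℝ (Θ.symm ∘ Θ) x = (fderiv ℝ Θ.symm (Θ x)).comp (fderiv ℝ Θ x) :=
    fderiv_comp x hds hd
  have hid : fderiv ℝ (Θ.symm ∘ Θ) x = ContinuousLinearMap.id ℝ _ := by
    have hev : (Θ.symm ∘ Θ) =ᶠ[𝓝 x] id := by
      filter_upwards [Θ.eventually_left_inverse hx] with y hy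
      exact hy
    rw [hev.fderiv_eq, fderiv_id]
  intro a b hab
  have := congrArg (fderiv ℝ Θ.symm (Θ x)) hab
  rw [← ContinuousLinearMap.comp_apply, ← ContinuousLinearMap.comp_apply, ← hcomp, hid] at this
  exact this

/-- **A filling of the crease that continues the chart shadow (step (S3)).**  In the setting
of files X–XI, given an inner collar `θ` of the unit sphere (`IsInnerCollar ε' θ θinv`,
`ε' ≤ η₀/R`) with `Λ₀ (R θ x) = G (R x)` on the closed shell `{1 - ε' < |x| ≤ 1}` (the output
of file XI), there are `η ∈ (0, η₀]` and a smooth `Λ : ℝ⁴ → ℝ⁴`, injective on the closed ball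
`B̄_R` with injective differential there, which equals `G` at every point of norm `≥ R - η`.
[folklore] -/
theorem exists_filling_of_innerCollar (hG : ContDiff ℝ ∞ G) (hΛ : ContDiff ℝ ∞ Λ₀) {R R' η₀ : ℝ}
    (hR : 0 < R) (hRR' : R < R') (hη₀ : 0 < η₀)
    (hΛimm : ∀ u ∈ ball (0 : EuclideanSpace ℝ (Fin 4)) R', Injective (fderiv ℝ Λ₀ u))
    (hΛinj : InjOn Λ₀ (ball (0 : EuclideanSpace ℝ (Fin 4)) R'))
    (hagree : ∀ u : EuclideanSpace ℝ (Fin 4), ‖u‖ = R → Λ₀ u = G u)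
    (hGinj : InjOn G {u : EuclideanSpace ℝ (Fin 4) | R - η₀ < ‖u‖ ∧ ‖u‖ < R + η₀})
    (hGimm : ∀ u : EuclideanSpace ℝ (Fin 4), R - η₀ < ‖u‖ → ‖u‖ < R + η₀ →
      Injective (fderiv ℝ G u))
    {ε' : ℝ} {θ θinv : EuclideanSpace ℝ (Fin 4) → EuclideanSpace ℝ (Fin 4)}
    (hε'η : ε' ≤ η₀ / R) (hcol : Literature.Topology.FourManifolds.IsInnerCollar ε' θ θinv)
    (hkey : ∀ x : EuclideanSpace ℝ (Fin 4), 1 - ε' < ‖x‖ → ‖x‖ ≤ 1 → Λ₀ (R • θ x) = G (R • x)) :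
    ∃ (η : ℝ) (Λ : EuclideanSpace ℝ (Fin 4) → EuclideanSpace ℝ (Fin 4)), 0 < η ∧ η ≤ η₀ ∧
      ContDiff ℝ ∞ Λ ∧ InjOn Λ (closedBall 0 R) ∧
      (∀ u ∈ closedBall (0 : EuclideanSpace ℝ (Fin 4)) R, Injective (fderiv ℝ Λ u)) ∧
      (∀ u : EuclideanSpace ℝ (Fin 4), R - η ≤ ‖u‖ → Λ u = G u) := by
  obtain ⟨Θ, δ', hδ', hδ'ε, hsrc, htgt, hΘsm, hΘsymsm, hΘeq, -⟩ :=
    hcol.exists_openPartialHomeomorph_extend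
  have hn : (∞ : WithTop ℕ∞) ≠ 0 := by simp
  have hΘsm' : ContDiffOn ℝ ∞ Θ Θ.source := by rw [hsrc]; exact hΘsm
  have hΘsymsm' : ContDiffOn ℝ ∞ Θ.symm Θ.target := by rw [htgt]; exact hΘsymsm
  have hRε'η : R * ε' ≤ η₀ := by
    calc R * ε' ≤ R * (η₀ / R) := by gcongr
      _ = η₀ := by field_simp
  -- the width of the agreement shell
  set η : ℝ := R * δ' with hη
  have hηpos : 0 < η := by positivity
  have hηle : η ≤ η₀ := by
    have : R * δ' ≤ R * ε' := by gcongr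
    linarith
  -- bookkeeping on norms
  have hnormR : ∀ x : EuclideanSpace ℝ (Fin 4), ‖R • x‖ = R * ‖x‖ := fun x => by
    rw [norm_smul, Real.norm_of_nonneg hR.le]
  have hnormRi : ∀ u : EuclideanSpace ℝ (Fin 4), ‖R⁻¹ • u‖ = R⁻¹ * ‖u‖ := fun u => by
    rw [norm_smul, Real.norm_of_nonneg (inv_nonneg.2 hR.le)]
  have hRRi : ∀ u : EuclideanSpace ℝ (Fin 4), R • (R⁻¹ • u) = u := fun u => by
    rw [smul_smul, mul_inv_cancel₀ hR.ne', one_smul]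
  have hball1 : ∀ u : EuclideanSpace ℝ (Fin 4), ‖u‖ < R → R⁻¹ • u ∈ Θ.source := by
    intro u hu
    rw [hsrc, mem_ball_zero_iff, hnormRi, inv_mul_lt_iff₀ hR, mul_one]
    exact hu
  have hΘball : ∀ x ∈ Θ.source, ‖Θ x‖ < 1 := by
    intro x hx
    have := Θ.map_source hx
    rw [htgt, mem_ball_zero_iff] at this
    exact this
  have hRΘ : ∀ u : EuclideanSpace ℝ (Fin 4), ‖u‖ < R → ‖R • Θ (R⁻¹ • u)‖ < R := by
    intro u hu
    rw [hnormR]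
    have := hΘball _ (hball1 u hu)
    nlinarith
  -- the filling
  obtain ⟨Λ, hΛdef⟩ : ∃ Λ : EuclideanSpace ℝ (Fin 4) → EuclideanSpace ℝ (Fin 4),
      Λ = fun u => if ‖u‖ < R then Λ₀ (R • Θ (R⁻¹ • u)) else G u := ⟨_, rfl⟩
  have hin : ∀ u : EuclideanSpace ℝ (Fin 4), ‖u‖ < R → Λ u = Λ₀ (R • Θ (R⁻¹ • u)) := by
    intro u hu; rw [hΛdef]; exact if_pos hu
  have hout : ∀ u : EuclideanSpace ℝ (Fin 4), R ≤ ‖u‖ → Λ u = G u := by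
    intro u hu; rw [hΛdef]; exact if_neg (not_lt.2 hu)
  -- agreement with `G` on `{R - η ≤ |u|}`
  have hagreeΛ : ∀ u : EuclideanSpace ℝ (Fin 4), R - η ≤ ‖u‖ → Λ u = G u := by
    intro u hu
    by_cases hlt : ‖u‖ < R
    · rw [hin u hlt]
      have h1 : 1 - δ' ≤ ‖R⁻¹ • u‖ := by
        rw [hnormRi, le_inv_mul_iff₀ hR]
        rw [hη] at hu
        linarith
      have h2 : ‖R⁻¹ • u‖ < 1 := by
        rw [hnormRi, inv_mul_lt_iff₀ hR, mul_one]; exact hlt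
      rw [hΘeq _ h1 h2, hkey _ (by linarith) h2.le, hRRi]
    · exact hout u (not_lt.1 hlt)
  -- the inner formula is smooth on the open ball
  have hinner : ContDiffOn ℝ ∞ (fun u => Λ₀ (R • Θ (R⁻¹ • u))) (ball 0 R) := by
    have h1 : ContDiffOn ℝ ∞ (fun u : EuclideanSpace ℝ (Fin 4) => Θ (R⁻¹ • u)) (ball 0 R) :=
      hΘsm'.comp (contDiff_const_smul R⁻¹).contDiffOn fun u hu => hball1 u (mem_ball_zero_iff.1 hu)
    exact hΛ.comp_contDiffOn (h1.const_smul R)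
  have hev_in : ∀ u : EuclideanSpace ℝ (Fin 4), ‖u‖ < R →
      Λ =ᶠ[𝓝 u] fun u => Λ₀ (R • Θ (R⁻¹ • u)) := by
    intro u hu
    filter_upwards [isOpen_ball.mem_nhds (mem_ball_zero_iff.2 hu)] with v hv
    exact hin v (mem_ball_zero_iff.1 hv)
  have hev_out : ∀ u : EuclideanSpace ℝ (Fin 4), R - η < ‖u‖ → Λ =ᶠ[𝓝 u] G := by
    intro u hu
    filter_upwards [(isOpen_lt continuous_const continuous_norm).mem_nhds hu] with v hv
    exact hagreeΛ v hv.le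
  refine ⟨η, Λ, hηpos, hηle, ?_, ?_, ?_, hagreeΛ⟩
  · -- smoothness
    rw [contDiff_iff_contDiffAt]
    intro u
    by_cases hlt : ‖u‖ < R
    · exact ((hinner.contDiffAt (isOpen_ball.mem_nhds (mem_ball_zero_iff.2 hlt))).congr_of_eventuallyEq
        (hev_in u hlt))
    · exact hG.contDiffAt.congr_of_eventuallyEq (hev_out u (by linarith [not_lt.1 hlt]))
  · -- injectivity on the closed ball
    intro u hu u' hu' huu'
    have hle : ‖u‖ ≤ R := mem_closedBall_zero_iff.1 hu
    have hle' : ‖u'‖ ≤ R := mem_closedBall_zero_iff.1 hu'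
    -- an interior value is never a boundary value
    have key : ∀ a b : EuclideanSpace ℝ (Fin 4), ‖a‖ < R → ‖b‖ = R → Λ a ≠ Λ b := by
      intro a b ha hb hab
      rw [hin a ha, hout b hb.ge, ← hagree b hb] at hab
      have h1 : R • Θ (R⁻¹ • a) ∈ ball (0 : EuclideanSpace ℝ (Fin 4)) R' :=
        mem_ball_zero_iff.2 ((hRΘ a ha).trans hRR')
      have h2 : b ∈ ball (0 : EuclideanSpace ℝ (Fin 4)) R' := mem_ball_zero_iff.2 (by rw [hb]; exact hRR')
      have := hΛinj h1 h2 hab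
      have h3 := hRΘ a ha
      rw [this, hb] at h3
      exact lt_irrefl _ h3
    rcases hle.lt_or_eq with h1 | h1 <;> rcases hle'.lt_or_eq with h2 | h2
    · rw [hin u h1, hin u' h2] at huu'
      have ha : R • Θ (R⁻¹ • u) ∈ ball (0 : EuclideanSpace ℝ (Fin 4)) R' :=
        mem_ball_zero_iff.2 ((hRΘ u h1).trans hRR')
      have hb : R • Θ (R⁻¹ • u') ∈ ball (0 : EuclideanSpace ℝ (Fin 4)) R' :=
        mem_ball_zero_iff.2 ((hRΘ u' h2).trans hRR')
      have h3 := smul_right_injective _ hR.ne' (hΛinj ha hb huu')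
      have h4 := Θ.injOn (hball1 u h1) (hball1 u' h2) h3
      exact smul_right_injective _ (inv_ne_zero hR.ne') h4
    · exact absurd huu' (key u u' h1 h2)
    · exact absurd huu'.symm (key u' u h2 h1)
    · rw [hout u h1.ge, hout u' h2.ge] at huu'
      exact hGinj ⟨by rw [h1]; linarith, by rw [h1]; linarith⟩ ⟨by rw [h2]; linarith, by rw [h2]; linarith⟩ huu'
  · -- immersivity on the closed ball
    intro u hu
    have hle : ‖u‖ ≤ R := mem_closedBall_zero_iff.1 hu
    by_cases hlt : ‖u‖ < R
    · rw [(hev_in u hlt).fderiv_eq]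
      -- chain rule through `Θ`
      set x := R⁻¹ • u with hx
      have hxs : x ∈ Θ.source := hball1 u hlt
      have hΘd : HasFDerivAt Θ (fderiv ℝ Θ x) x :=
        ((hΘsm'.differentiableOn hn x hxs).differentiableAt (Θ.open_source.mem_nhds hxs)).hasFDerivAt
      have hs1 : HasFDerivAt (fun v : EuclideanSpace ℝ (Fin 4) => R⁻¹ • v)
          (R⁻¹ • ContinuousLinearMap.id ℝ (EuclideanSpace ℝ (Fin 4))) u :=
        (hasFDerivAt_id u).const_smul R⁻¹
      have hs2 : HasFDerivAt (fun v : EuclideanSpace ℝ (Fin 4) => R • v)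
          (R • ContinuousLinearMap.id ℝ (EuclideanSpace ℝ (Fin 4))) (Θ x) :=
        (hasFDerivAt_id _).const_smul R
      have hΛd : HasFDerivAt Λ₀ (fderiv ℝ Λ₀ (R • Θ x)) (R • Θ x) :=
        (hΛ.differentiable hn _).hasFDerivAt
      have hc1 : HasFDerivAt (fun v : EuclideanSpace ℝ (Fin 4) => Θ (R⁻¹ • v))
          ((fderiv ℝ Θ x).comp (R⁻¹ • ContinuousLinearMap.id ℝ (EuclideanSpace ℝ (Fin 4)))) u :=
        hΘd.comp u hs1
      have hc2 := hs2.comp u hc1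
      have hc3 : HasFDerivAt (fun v : EuclideanSpace ℝ (Fin 4) => Λ₀ (R • Θ (R⁻¹ • v)))
          ((fderiv ℝ Λ₀ (R • Θ x)).comp ((R • ContinuousLinearMap.id ℝ (EuclideanSpace ℝ (Fin 4))).comp
            ((fderiv ℝ Θ x).comp (R⁻¹ • ContinuousLinearMap.id ℝ (EuclideanSpace ℝ (Fin 4)))))) u :=
        hΛd.comp u hc2
      rw [hc3.fderiv]
      have i1 : Injective (fderiv ℝ Λ₀ (R • Θ x)) :=
        hΛimm _ (mem_ball_zero_iff.2 ((hRΘ u hlt).trans hRR'))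
      have i2 : Injective (R • ContinuousLinearMap.id ℝ (EuclideanSpace ℝ (Fin 4))) := by
        intro a b hab
        have hab' : R • a = R • b := hab
        exact smul_right_injective (EuclideanSpace ℝ (Fin 4)) hR.ne' hab'
      have i3 : Injective (fderiv ℝ Θ x) := injective_fderiv_of_symm hΘsm' hΘsymsm' hxs
      have i4 : Injective (R⁻¹ • ContinuousLinearMap.id ℝ (EuclideanSpace ℝ (Fin 4))) := by
        intro a b hab
        have hab' : R⁻¹ • a = R⁻¹ • b := hab
        exact smul_right_injective (EuclideanSpace ℝ (Fin 4)) (inv_ne_zero hR.ne') hab'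
      rw [ContinuousLinearMap.coe_comp, ContinuousLinearMap.coe_comp, ContinuousLinearMap.coe_comp]
      exact i1.comp (i2.comp (i3.comp i4))
    · have hR' : ‖u‖ = R := le_antisymm hle (not_lt.1 hlt)
      rw [(hev_out u (by rw [hR']; linarith)).fderiv_eq]
      exact hGimm u (by rw [hR']; linarith) (by rw [hR']; linarith)

end Straighten

end Summit.SmoothPoincare4.SmoothPoincare4.Theorems.OrigamiFoldExistence.ShadowPleats

end
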